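import Literature.AlgebraicGeometry.Frobenioids.DivisorMonoidIsoEmbeddingDescent
import Literature.AlgebraicGeometry.Frobenioids.PerfectionFunctoriality
import Literature.AlgebraicGeometry.Frobenioids.PerfectionProofs
import Literature.AlgebraicGeometry.Frobenioids.CoAngular
import HarnessLib

/-!
# [FrdI] Theorem 4.9, proof p. 89 ll. 25–33 / 38–41: "by passing to perfections … we may assume … perfect
# type" — the DESCENT of `Ψ^Φ` from THE perfections `C_i^pf` to the `C_i` (PROVED)

Mochizuki, *The geometry of Frobenioids I: the general theory*, Kyushu J. Math. **62** (2008) 293–400,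
§4, proof of Theorem 4.9, kurims text p. 89 [cite: MochizukiFrdI2008, Thm. 4.9 p.89]:

> "… one concludes immediately that this [isomorphism `Φ₁(A₁)^pf ⥲ Φ₂(A₂)^pf`] maps the subset
> `Φ₁(A₁) ⊆ Φ₁(A₁)^pf` onto the subset `Φ₂(A₂) ⊆ Φ₂(A₂)^pf`, hence determines an isomorphism of monoids
> `Φ₁(A₁) ⥲ Φ₂(A₂)` which is functorial in `A₁`" … "by passing to perfections [cf. Theorem 3.4, (iii)], we
> may assume without loss of generality that `C₁`, `C₂` are of perfect type".

PROOF-ONLY file (seat abc-iut-w4-d109; S5 sub-DAG [FrdI] Thm. 4.9, row `FrdI:Thm4.9/T49-L00` assembly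
piece "pf → C"). It instantiates the generic transport
`PreFrobenioidData.DivisorMonoidIsoOver.nonempty_of_embedding` (`DivisorMonoidIsoEmbeddingDescent.lean`) at
THE perfections of seat abc-iut-L1-d9's chain (`PreFrobenioid.Perfection hF_i`, operations
`Perfection.ops hF_i`, functor `toPf hF_i : C_i → C_i^pf`) and the induced equivalence
`Ψ^pf := Perfection.map hΨ` with its `1`-commutative square `toPf₁ ⋙ Ψ^pf ≅ Ψ ⋙ toPf₂`
(Thm. 3.4 (iii), `PerfectionFunctoriality.lean`): the base identifications are identities
(`baseMap_toPf`, `map_toPf_map`), the embedding `Φ_i ↪ Φ_i^pf` is `Perfection.of` (natural on the nose;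
injective because the `Φ_i(X)` are divisorial, `of_injective_of_isSharp_isIntegral_isSaturated`),
and the image condition "`Φ₁(A₁) ⊆ Φ₁(A₁)^pf` onto `Φ₂(A₂)`" follows from the RIGHT-HAND property of the
perfect-level `Ψ^Φ` ("`Ψ^Φ(Div φ) = Div(Ψ^pf φ)` for pre-steps `φ`", the shape row T49-L02 delivers) via
pre-steps with prescribed zero divisor (Def. 1.3 (iii)(d)), `Div(toPf φ) = Div(φ)^{1/1}` (`div_toPf`,
Prop. 3.2 (i)) and "`Ψ⁻¹` preserves pre-steps" (Thm. 3.4 (ii)).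

* `FrdI.T49.nonempty_divisorMonoidIsoOver_of_perfection` — for Frobenioids `C_i → F_{Φ_i}`, an equivalence
  `Ψ` compatible with arrows of Frobenius type whose quasi-inverse preserves pre-steps, and an isomorphism of
  functors `Φ₁^pf ⥲ Φ₂^pf` over `Ψ^pf` on the `C_i^pf` with the right-hand property, there is an isomorphism of
  functors `Ψ^Φ : Φ₁ ⥲ Φ₂` lying over `Ψ` on the `C_i` (the closing shape
  `PreFrobenioidData.DivisorMonoidIsoOver (ofFunctor Φ₁ F₁) (ofFunctor Φ₂ F₂) Ψ` of `Thm49`).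

No new definitions; nothing of [FrdI] restated or strengthened; nothing here bears on [IUTchIII] Cor. 3.12.
-/

namespace Literature.AlgebraicGeometry.Frobenioids

namespace FrdI.T49

open CategoryTheory Opposite PreFrobenioidData

universe w₁ v₁ v₁' u₁ u₁' w₂ v₂ v₂' u₂ u₂'

variable {D₁ : Type u₁} [Category.{v₁} D₁] {Φ₁ : D₁ᵒᵖ ⥤ CommMonCat.{w₁}}
  {C₁ : Type u₁'} [Category.{v₁'} C₁] {F₁ : C₁ ⥤ ElemFrobenioid Φ₁}
  {D₂ : Type u₂} [Category.{v₂} D₂] {Φ₂ : D₂ᵒᵖ ⥤ CommMonCat.{w₂}}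
  {C₂ : Type u₂'} [Category.{v₂'} C₂] {F₂ : C₂ ⥤ ElemFrobenioid Φ₂}

/-- The embedding `Φ(X) ↪ Φ(X)^pf` is injective for the (divisorial) divisor monoids of a pre-Frobenioid
(a divisorial monoid is sharp, integral and saturated; FrdI §0 p. 11 / Def. 1.1 (i)).
[cite: MochizukiFrdI2008, Def. 1.1 (i) p.19] -/
theorem perfectionOf_injective (hP : IsPreFrobenioid Φ₁ F₁) (X : D₁) :
    Function.Injective (Perfection.of (Φ₁.obj (op X))) :=
  of_injective_of_isSharp_isIntegral_isSaturated (hP.isDivisorial X).isSharp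
    (hP.isDivisorial X).isPreDivisorial.isIntegral (hP.isDivisorial X).isPreDivisorial.isSaturated

/-- In a pre-Frobenioid, post-composing with an isomorphism does not change the zero divisor:
`Div(e ∘ ψ) = Base(ψ)^* Div(e) + deg_Fr(e) · Div(ψ) = Div(ψ)` (Rem. 1.1.1; isomorphisms are linear
isometries). [cite: MochizukiFrdI2008, Rem. 1.1.1 p.20] -/
theorem div_comp_iso (hP : IsPreFrobenioid Φ₂ F₂) {X Y Z : C₂} (ψ : X ⟶ Y) (e : Y ⟶ Z) [IsIso e] :
    PreFrobenioid.Div F₂ (ψ ≫ e) = PreFrobenioid.Div F₂ ψ := by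
  rw [PreFrobenioid.div_comp, show PreFrobenioid.Div F₂ e = 1 from PreFrobenioid.isIsometry_of_isIso F₂ hP e,
    map_one, one_mul, show PreFrobenioid.degFr F₂ e = 1 from PreFrobenioid.isLinear_of_isIso F₂ e,
    PNat.one_coe, pow_one]

/-- **Descent of `Ψ^Φ` from the perfections** ("by passing to perfections … we may assume … perfect type",
FrdI p. 89 ll. 38–41, with "maps the subset `Φ₁(A₁) ⊆ Φ₁(A₁)^pf` onto the subset `Φ₂(A₂)`", p. 89
ll. 25–33): let `C_i → F_{Φ_i}` be Frobenioids, `Ψ : C₁ ⥲ C₂` an equivalence carrying arrows of Frobenius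
type to arrows of Frobenius type of the same degree (Thm. 3.4 (iii), so that `Ψ^pf : C₁^pf ⥲ C₂^pf` is
defined and is an equivalence) whose quasi-inverse carries pre-steps to pre-steps (Thm. 3.4 (ii)). Then every
isomorphism of functors `E' : Φ₁^pf ⥲ Φ₂^pf` lying over `Ψ^pf` on the perfections which has the RIGHT-HAND
property "`E'(Div φ) = Div(Ψ^pf φ)` for every pre-step `φ` of `C₁^pf`" restricts — along `Φ_i ↪ Φ_i^pf` and
the square `toPf₁ ⋙ Ψ^pf ≅ Ψ ⋙ toPf₂` — to an isomorphism of functors `Ψ^Φ : Φ₁ ⥲ Φ₂` lying over `Ψ` on the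
`C_i`. [cite: MochizukiFrdI2008, Thm. 4.9 p.89] -/
theorem nonempty_divisorMonoidIsoOver_of_perfection (hF₁ : PreFrobenioid.IsFrobenioid F₁)
    (hF₂ : PreFrobenioid.IsFrobenioid F₂) (Ψ : C₁ ≌ C₂)
    (hΨ : PreFrobenioid.IsFrobeniusCompatible F₁ F₂ Ψ.functor)
    (hinv : ∀ ⦃X Y : C₂⦄ (g : X ⟶ Y), PreFrobenioid.IsPreStep F₂ g → PreFrobenioid.IsPreStep F₁ (Ψ.inverse.map g))
    (E' : haveI := PreFrobenioid.Perfection.map_isEquivalence (hF₁ := hF₁) (hF₂ := hF₂) Ψ hΨ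
      DivisorMonoidIsoOver (PreFrobenioid.Perfection.ops hF₁) (PreFrobenioid.Perfection.ops hF₂)
        (PreFrobenioid.Perfection.map (hF₁ := hF₁) (hF₂ := hF₂) hΨ).asEquivalence)
    (hE' : ∀ ⦃X Y : PreFrobenioid.Perfection hF₁⦄ (f : X ⟶ Y), (PreFrobenioid.Perfection.ops hF₁).IsPreStep f →
      E'.iso X ((PreFrobenioid.Perfection.ops hF₁).div f) =
        (PreFrobenioid.Perfection.ops hF₂).div ((PreFrobenioid.Perfection.map (hF₁ := hF₁) (hF₂ := hF₂) hΨ).map f)) :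
    Nonempty (DivisorMonoidIsoOver (ofFunctor Φ₁ F₁) (ofFunctor Φ₂ F₂) Ψ) := by
  haveI := PreFrobenioid.Perfection.map_isEquivalence (hF₁ := hF₁) (hF₂ := hF₂) Ψ hΨ
  have hP₁ := hF₁.isPreFrobenioid
  have hP₂ := hF₂.isPreFrobenioid
  -- the value of `E'` on the image of `Φ₁(A)`: `E'_{(A,1)}(Div(φ)^{1/1}) = Div(Ψ φ)^{1/1}` for pre-steps `φ`
  have key : ∀ ⦃A B : C₁⦄ (φ : A ⟶ B), PreFrobenioid.IsPreStep F₁ φ →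
      E'.iso ((PreFrobenioid.Perfection.toPf hF₁).obj A) (Perfection.of _ (PreFrobenioid.Div F₁ φ)) =
        Perfection.of _ (PreFrobenioid.Div F₂ (Ψ.functor.map φ)) := by
    intro A B φ hφ
    have h := hE' ((PreFrobenioid.Perfection.toPf hF₁).map φ)
      (PreFrobenioid.Perfection.preservesMor_isPreStep hF₁ φ ((ofFunctor_isPreStep F₁ φ).2 hφ))
    rw [PreFrobenioid.Perfection.map_toPf_map hΨ φ] at h
    change (E'.iso _) (PreFrobenioid.Perfection.Hom.div ((PreFrobenioid.Perfection.toPf hF₁).map φ)) =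
      PreFrobenioid.Perfection.Hom.div ((PreFrobenioid.Perfection.toPf hF₂).map (Ψ.functor.map φ)) at h
    rw [PreFrobenioid.Perfection.div_toPf, PreFrobenioid.Perfection.div_toPf] at h
    exact h
  refine DivisorMonoidIsoOver.nonempty_of_embedding (S₁ := ofFunctor Φ₁ F₁) (S₂ := ofFunctor Φ₂ F₂)
    (S₁' := PreFrobenioid.Perfection.ops hF₁) (S₂' := PreFrobenioid.Perfection.ops hF₂)
    (Ψ' := (PreFrobenioid.Perfection.map (hF₁ := hF₁) (hF₂ := hF₂) hΨ).asEquivalence)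
    (PreFrobenioid.Perfection.toPf hF₁) (fun A => Iso.refl _) (fun A B φ => ?_) (fun A => Iso.refl _)
    (fun A B φ => ?_)
    (fun X => Perfection.of (Φ₁.obj (op X))) (fun X Y f x => rfl) (perfectionOf_injective hP₁)
    (fun X => Perfection.of (Φ₂.obj (op X))) (fun X Y f x => rfl) (perfectionOf_injective hP₂)
    E' (fun A => ⟨fun x => ?_, fun z => ?_⟩)
  · -- `toPf` lies over the base on the nose (Prop. 3.2 (i))
    change 𝟙 _ ≫ PreFrobenioid.Base F₁ φ =
      PreFrobenioid.Perfection.Hom.baseMap ((PreFrobenioid.Perfection.toPf hF₁).map φ) ≫ 𝟙 _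
    rw [Category.id_comp, Category.comp_id, PreFrobenioid.Perfection.baseMap_toPf]
  · -- `Ψ^pf (toPf φ) = toPf (Ψ φ)` (Thm. 3.4 (iii)) and Prop. 3.2 (i) again
    change 𝟙 _ ≫ PreFrobenioid.Base F₂ (Ψ.functor.map φ) =
      PreFrobenioid.Perfection.Hom.baseMap
        ((PreFrobenioid.Perfection.map (hF₁ := hF₁) (hF₂ := hF₂) hΨ).map
          ((PreFrobenioid.Perfection.toPf hF₁).map φ)) ≫ 𝟙 _
    rw [Category.id_comp, Category.comp_id]
    exact ((congrArg PreFrobenioid.Perfection.Hom.baseMap (PreFrobenioid.Perfection.map_toPf_map hΨ φ)).trans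
      (PreFrobenioid.Perfection.baseMap_toPf (hF := hF₂) (Ψ.functor.map φ))).symm
  · -- `Φ₁(A) → Φ₂(Ψ A)`: `x = Div(φ)` for a pre-step `φ` out of `A` (Def. 1.3 (iii)(d))
    obtain ⟨B, φ, hφ, rfl⟩ := hF₁.iii_d_under_surj A x
    refine ⟨PreFrobenioid.Div F₂ (Ψ.functor.map φ), ?_⟩
    change E'.iso _ ((PreFrobenioid.Perfection.ops hF₁).pull (𝟙 _) _) =
      (PreFrobenioid.Perfection.ops hF₂).pull (𝟙 _) _
    rw [(PreFrobenioid.Perfection.ops hF₁).pull_id, (PreFrobenioid.Perfection.ops hF₂).pull_id]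
    exact key φ hφ.2
  · -- `Φ₂(Ψ A) → Φ₁(A)`: `z = Div(ψ')` for a pre-step `ψ'` out of `Ψ A`; pull it back along `Ψ`
    obtain ⟨B', ψ', hψ', rfl⟩ := hF₂.iii_d_under_surj (Ψ.functor.obj A) z
    -- the unit and counit of `Ψ` at `A`, `B'`, as isomorphisms with plainly typed ends
    obtain ⟨u, hu⟩ : ∃ u : A ≅ Ψ.inverse.obj (Ψ.functor.obj A), u.hom = Ψ.unit.app A :=
      ⟨Ψ.unitIso.app A, rfl⟩
    obtain ⟨c, hc⟩ : ∃ c : Ψ.functor.obj (Ψ.inverse.obj B') ≅ B', c.inv = Ψ.counitInv.app B' :=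
      ⟨Ψ.counitIso.app B', rfl⟩
    obtain ⟨c', hc'⟩ : ∃ c' : Ψ.functor.obj (Ψ.inverse.obj (Ψ.functor.obj A)) ≅ Ψ.functor.obj A,
        c'.hom = Ψ.counit.app (Ψ.functor.obj A) :=
      ⟨Ψ.counitIso.app (Ψ.functor.obj A), rfl⟩
    -- `φ := Ψ⁻¹(ψ') ∘ η_A : A → Ψ⁻¹ B'` is a pre-step with `Ψ φ = ε_{B'}⁻¹ ∘ ψ'`, so `Div(Ψ φ) = Div(ψ')`
    have hφ : PreFrobenioid.IsPreStep F₁ (u.hom ≫ Ψ.inverse.map ψ') :=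
      PreFrobenioid.IsPreStep.comp F₁ (PreFrobenioid.isPreStep_of_isIso F₁ u.hom) (hinv ψ' hψ'.2)
    have hΨφ : Ψ.functor.map (u.hom ≫ Ψ.inverse.map ψ') = ψ' ≫ c.inv := by
      -- (stated over plainly typed ends; the library's triangle identities are used up to unfolding)
      have h₁ : Ψ.functor.map (Ψ.inverse.map ψ') = c'.hom ≫ ψ' ≫ c.inv := by
        rw [hc, hc']
        exact Ψ.fun_inv_map _ _ ψ'
      have h₂ : Ψ.functor.map u.hom ≫ c'.hom = 𝟙 (Ψ.functor.obj A) := by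
        rw [hu, hc']
        exact Ψ.functor_unit_comp A
      rw [Functor.map_comp, h₁, ← Category.assoc, h₂, Category.id_comp]
    have hdiv : PreFrobenioid.Div F₂ (Ψ.functor.map (u.hom ≫ Ψ.inverse.map ψ')) = PreFrobenioid.Div F₂ ψ' := by
      rw [hΨφ]
      exact div_comp_iso hP₂ ψ' c.inv
    refine ⟨PreFrobenioid.Div F₁ (u.hom ≫ Ψ.inverse.map ψ'), ?_⟩
    change E'.iso _ ((PreFrobenioid.Perfection.ops hF₁).pull (𝟙 _) _) =
      (PreFrobenioid.Perfection.ops hF₂).pull (𝟙 _) _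
    rw [(PreFrobenioid.Perfection.ops hF₁).pull_id, (PreFrobenioid.Perfection.ops hF₂).pull_id]
    exact (key _ hφ).trans (congrArg (Perfection.of _) hdiv)

end FrdI.T49

end Literature.AlgebraicGeometry.Frobenioids
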